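import Summits.Ventures.Crystal3D.Theorems.StickyWulffConstantCoaxialWallLawVicinalCoherence
import Summits.Ventures.Crystal3D.Theorems.StickyWulffConstantCoaxialWallLawMenuFrames
import Summits.Ventures.Crystal3D.Theorems.StickyWulffConstantCoaxialWallLawTriadicRegistry
import Summits.Ventures.Crystal3D.Theorems.StickyWulffConstantCoaxialWallLawModelNormals
import HarnessLib

/-!
# Vicinal level-⅓ translation pairs are BASAL STACKING FAULTS of the nearest axis (crux `CoaxialWallLaw`,
# stmt-Ventures-19481, line `WallLedgerF`)

HONEST FRAMING. Venture `Summits/Ventures/Crystal3D` (cell `crystal3d-full`), helper `--supports` the crux `CoaxialWallLaw`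
of `route-Ventures-StickyWulffConstant` (REGISTERED line `WallLedgerF`, open stub `stub_coaxialTwoSlabAdhesion`).  Pure lattice
geometry about the vicinal core (`…VicinalCore`, `…VicinalSplit`); rung credit; F-C1 not moved; NOT the crux; no census.

**`coherentFaultPair_of_vicinal_level_third`** — a pair in the VICINAL CORE with EQUAL linear lattices and a level-⅓ offset is a
COHERENT FAULT pair: `t₂ − t₁ ∈ A₁·(Λ₀ + ℤ√(2/3)ν)` for the `{111}` axis `ν` of grain 1 NEAREST to the cell vertical `e₃`
(`CoherentFaultPair`).  Proof: take `ν` maximising `⟪ν, e₃⟫` among the (finitely many: `exists_cubeVec_of_menu`) unit menu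
normals; the mirrored normals `2√(2/3)A₁uₖ − ν` of its three rising slots are menu normals too (`menu_mirror_slot`), so
maximality gives `0 ≤ ⟪A₁uₖ, e₃⟫ ≤ √(3/2)⟪ν, e₃⟫`; by `two_good_rising_slots` two rising slots are wide (`≥ ½`) and dominate
`ν`; hypothesis (iii) of the core registers the offset for both; `coherentOffset_of_two_registrations` concludes.
CONSEQUENCE (`incoherent_trans_not_level_third`, with `…VicinalCoherentTwin`): the INCOHERENT debt
`CoaxialTwoSlabAdhesionIncoherent` of `…VicinalSplit` contains NO level-⅓ pair at all — the level-⅓ incoherent classes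
(two-partial `⅓·slot`, `⅓⟨200⟩`, displaced twins) are FREE for arbitrary fillings at EVERY wall orientation; what remains
incoherent is of deeper level `3^{-j}`, `j ≥ 2` (numerics calc/vicinal_survivors.py: 0 of 20000 Haar normals keep an incoherent
level-⅓ translation class).
WHAT THIS IS NOT: not the stub; F-C1 not moved.
-/

noncomputable section

namespace Summit.Ventures.Crystal3D.Theorems

open Summit.Ventures.Crystal3D Finset NearIdentity
open Literature.MathematicalPhysics.StatisticalMechanics (fccStacking barlowStacking IsHaggSeq contactDeficiency)
open scoped InnerProductSpace

/-- **The unit menu normals of a frame are among eight explicit vectors** (cubic coordinates `(±1,±1,±1)/√3`). -/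
theorem exists_cubeVec_of_menu (A : EuclideanSpace ℝ (Fin 3) ≃ₗᵢ[ℝ] EuclideanSpace ℝ (Fin 3))
    {m : EuclideanSpace ℝ (Fin 3)} (hm : ‖m‖ = 1)
    (hmenu : ∀ w ∈ fccSlots, ⟪A w, m⟫_ℝ = 0 ∨ ⟪A w, m⟫_ℝ = Real.sqrt (2 / 3) ∨ ⟪A w, m⟫_ℝ = -Real.sqrt (2 / 3)) :
    ∃ c : Fin 8, m = A (∑ j : Fin 3, ((cubeInt c j : ℝ) / Real.sqrt 3) • cubicFrame j) := by
  obtain ⟨k, hk, hkj⟩ := menu_cubic_coords_pm_one A hm hmenu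
  have h3 : (0 : ℝ) < Real.sqrt 3 := Real.sqrt_pos.2 (by norm_num)
  have hcoef : ∀ j, ⟪m, A (cubicFrame j)⟫_ℝ = (k j : ℝ) / Real.sqrt 3 := by
    intro j
    have h := hkj j
    rw [real_inner_comm]
    field_simp
    linarith
  have hkR : ∀ j, (k j : ℝ) = 1 ∨ (k j : ℝ) = -1 := by
    intro j; rcases hk j with h | h <;> rw [h] <;> norm_num
  obtain ⟨c, hc0, hc1, hc2⟩ := exists_cubeInt_eq _ _ _ (hkR 0) (hkR 1) (hkR 2)
  have hc : ∀ j, (cubeInt c j : ℝ) = k j := by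
    intro j; fin_cases j
    · exact hc0
    · exact hc1
    · exact hc2
  refine ⟨c, ?_⟩
  rw [map_sum]
  conv_lhs => rw [eq_sum_cubicFrame A m]
  exact Finset.sum_congr rfl fun j _ => by rw [map_smul, hcoef j, hc j]

/-- The mirrored normal of a rising slot is a unit vector. -/
theorem norm_mirror_normal {w ν : EuclideanSpace ℝ (Fin 3)} (hw : ‖w‖ = 1) (hν : ‖ν‖ = 1)
    (hwν : ⟪w, ν⟫_ℝ = Real.sqrt (2 / 3)) : ‖(2 * Real.sqrt (2 / 3)) • w - ν‖ = 1 := by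
  have h23 : Real.sqrt (2 / 3) * Real.sqrt (2 / 3) = 2 / 3 := Real.mul_self_sqrt (by norm_num)
  have hww : ⟪w, w⟫_ℝ = 1 := by rw [real_inner_self_eq_norm_sq, hw, one_pow]
  have hνν : ⟪ν, ν⟫_ℝ = 1 := by rw [real_inner_self_eq_norm_sq, hν, one_pow]
  have h : ⟪(2 * Real.sqrt (2 / 3)) • w - ν, (2 * Real.sqrt (2 / 3)) • w - ν⟫_ℝ = 1 := by
    have hνw : ⟪ν, w⟫_ℝ = Real.sqrt (2 / 3) := by rw [real_inner_comm, hwν]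
    rw [inner_sub_left, inner_sub_right, inner_sub_right, real_inner_smul_left, real_inner_smul_right,
      real_inner_smul_left, real_inner_smul_right, hww, hνν]
    simp only [hwν, hνw]
    nlinarith [h23]
  rw [real_inner_self_eq_norm_sq] at h
  nlinarith [norm_nonneg ((2 * Real.sqrt (2 / 3)) • w - ν)]

open scoped Classical in
/-- **Vicinal level-⅓ translation pairs are coherent faults.**  See the module docstring. -/
theorem coherentFaultPair_of_vicinal_level_third
    (A₁ : EuclideanSpace ℝ (Fin 3) ≃ₗᵢ[ℝ] EuclideanSpace ℝ (Fin 3)) (t₁ : EuclideanSpace ℝ (Fin 3))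
    (A₂ : EuclideanSpace ℝ (Fin 3) ≃ₗᵢ[ℝ] EuclideanSpace ℝ (Fin 3)) (t₂ : EuclideanSpace ℝ (Fin 3))
    (hV : VicinalPair A₁ t₁ A₂ t₂)
    (hΛ : A₂ '' fccStacking 1 (Real.sqrt (2 / 3)) = A₁ '' fccStacking 1 (Real.sqrt (2 / 3)))
    (h3 : A₁.symm ((3 : ℝ) • (t₂ - t₁)) ∈ fccStacking 1 (Real.sqrt (2 / 3))) :
    CoherentFaultPair A₁ t₁ A₂ t₂ := by
  set e : EuclideanSpace ℝ (Fin 3) := EuclideanSpace.single (2 : Fin 3) (1 : ℝ) with he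
  have hen : ‖e‖ = 1 := by rw [he, PiLp.norm_single, norm_one]
  obtain ⟨_, _, hreg⟩ := hV
  -- the finite family of unit menu normals and the NEAREST axis `ν`
  set P : EuclideanSpace ℝ (Fin 3) → Prop := fun m => ‖m‖ = 1 ∧
    ∀ w ∈ fccSlots, ⟪A₁ w, m⟫_ℝ = 0 ∨ ⟪A₁ w, m⟫_ℝ = Real.sqrt (2 / 3) ∨ ⟪A₁ w, m⟫_ℝ = -Real.sqrt (2 / 3) with hP
  set S : Finset (EuclideanSpace ℝ (Fin 3)) :=
    ((Finset.univ : Finset (Fin 8)).image fun c => A₁ (∑ j : Fin 3, ((cubeInt c j : ℝ) / Real.sqrt 3) • cubicFrame j)).filter P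
    with hS
  have hmemS : ∀ m : EuclideanSpace ℝ (Fin 3), P m → m ∈ S := by
    intro m hm
    rw [hS, Finset.mem_filter]
    refine ⟨?_, hm⟩
    obtain ⟨c, hc⟩ := exists_cubeVec_of_menu A₁ hm.1 hm.2
    exact Finset.mem_image.2 ⟨c, Finset.mem_univ _, hc.symm⟩
  obtain ⟨m₀, hm₀, hm₀menu, -⟩ := exists_menuNormal_far A₁ (slotSite_mem 0)
  have hSne : S.Nonempty := ⟨m₀, hmemS m₀ ⟨hm₀, hm₀menu⟩⟩
  obtain ⟨ν, hνS, hmax⟩ := S.exists_max_image (fun m => ⟪m, e⟫_ℝ) hSne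
  have hPν : P ν := (Finset.mem_filter.1 (by rw [hS] at hνS; exact hνS)).2
  obtain ⟨hν, hmenu⟩ := hPν
  have hmax' : ∀ m : EuclideanSpace ℝ (Fin 3), P m → ⟪m, e⟫_ℝ ≤ ⟪ν, e⟫_ℝ := fun m hm => hmax m (hmemS m hm)
  set c : ℝ := ⟪ν, e⟫_ℝ with hcdef
  -- `c ≥ 0` (compare with `−ν`)
  have hc0 : 0 ≤ c := by
    have h := hmax' (-ν) ⟨by rw [norm_neg, hν], fun w hw => by
      rw [inner_neg_right]
      rcases hmenu w hw with h | h | h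
      · exact Or.inl (by rw [h, neg_zero])
      · exact Or.inr (Or.inr (by rw [h]))
      · exact Or.inr (Or.inl (by rw [h, neg_neg]))⟩
    rw [inner_neg_left] at h
    linarith
  -- the three rising slots of `ν` and the bounds from maximality
  obtain ⟨u₁, hu₁, u₂, hu₂, u₃, hu₃, hn₁, hn₂, hn₃, h12, h13, h23, -, -⟩ := exists_far_frame A₁ hν hmenu
  have nw : ∀ u ∈ fccSlots, ‖A₁ u‖ = 1 := fun u hu => by rw [LinearIsometryEquiv.norm_map, norm_eq_one_of_mem_fccSlots hu]
  have ip : ∀ u u' : EuclideanSpace ℝ (Fin 3), ⟪A₁ u, A₁ u'⟫_ℝ = ⟪u, u'⟫_ℝ := fun u u' => A₁.inner_map_map u u'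
  have h23' : Real.sqrt (2 / 3) ^ 2 = 2 / 3 := Real.sq_sqrt (by norm_num)
  have hr0 : 0 < Real.sqrt (2 / 3) := Real.sqrt_pos.2 (by norm_num)
  have bounds : ∀ u ∈ fccSlots, ⟪A₁ u, ν⟫_ℝ = Real.sqrt (2 / 3) →
      0 ≤ ⟪A₁ u, e⟫_ℝ ∧ 2 * ⟪A₁ u, e⟫_ℝ ^ 2 ≤ 3 * ⟪ν, e⟫_ℝ ^ 2 := by
    intro u hu hun
    set n' : EuclideanSpace ℝ (Fin 3) := (2 * Real.sqrt (2 / 3)) • A₁ u - ν with hn'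
    have hn'1 : ‖n'‖ = 1 := norm_mirror_normal (nw u hu) hν hun
    have hn'menu := menu_mirror_slot A₁ hmenu hu hun
    have hle := hmax' n' ⟨hn'1, hn'menu⟩
    have hle' := hmax' (-n') ⟨by rw [norm_neg, hn'1], fun w hw => by
      rw [inner_neg_right]
      rcases hn'menu w hw with h | h | h
      · exact Or.inl (by rw [h, neg_zero])
      · exact Or.inr (Or.inr (by rw [h]))
      · exact Or.inr (Or.inl (by rw [h, neg_neg]))⟩
    have hn'e : ⟪n', e⟫_ℝ = 2 * Real.sqrt (2 / 3) * ⟪A₁ u, e⟫_ℝ - c := by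
      rw [hn', inner_sub_left, real_inner_smul_left, hcdef]
    rw [inner_neg_left, hn'e] at hle'
    rw [hn'e] at hle
    rw [← hcdef]
    constructor
    · nlinarith [hle', hr0]
    · -- `√(2/3)·⟪A₁u,e⟫ ≤ c` with both sides `≥ 0`
      have h1 : Real.sqrt (2 / 3) * ⟪A₁ u, e⟫_ℝ ≤ c := by linarith
      have h0 : 0 ≤ Real.sqrt (2 / 3) * ⟪A₁ u, e⟫_ℝ := by nlinarith [hle', hr0]
      have := mul_le_mul h1 h1 h0 hc0
      nlinarith [this, h23']
  obtain ⟨hl₁, hh₁⟩ := bounds u₁ hu₁ hn₁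
  obtain ⟨hl₂, hh₂⟩ := bounds u₂ hu₂ hn₂
  obtain ⟨hl₃, hh₃⟩ := bounds u₃ hu₃ hn₃
  obtain ⟨wᵢ, wⱼ, hcases, ⟨hiw, hid⟩, ⟨hjw, hjd⟩⟩ := two_good_rising_slots (nw u₁ hu₁) (nw u₂ hu₂) (nw u₃ hu₃) hν hen
    (by rw [ip]; exact h12) (by rw [ip]; exact h13) (by rw [ip]; exact h23) hn₁ hn₂ hn₃ hc0 ⟨hl₁, hl₂, hl₃⟩ ⟨hh₁, hh₂, hh₃⟩
  obtain ⟨uᵢ, uⱼ, huᵢ, huⱼ, hij, rfl, rfl⟩ : ∃ uᵢ uⱼ : EuclideanSpace ℝ (Fin 3), uᵢ ∈ fccSlots ∧ uⱼ ∈ fccSlots ∧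
      ⟪uᵢ, uⱼ⟫_ℝ = 1 / 2 ∧ wᵢ = A₁ uᵢ ∧ wⱼ = A₁ uⱼ := by
    rcases hcases with ⟨rfl, rfl⟩ | ⟨rfl, rfl⟩ | ⟨rfl, rfl⟩
    · exact ⟨u₁, u₂, hu₁, hu₂, h12, rfl, rfl⟩
    · exact ⟨u₁, u₃, hu₁, hu₃, h13, rfl, rfl⟩
    · exact ⟨u₂, u₃, hu₂, hu₃, h23, rfl, rfl⟩
  have hiν : ⟪A₁ uᵢ, ν⟫_ℝ = Real.sqrt (2 / 3) := by
    rcases hcases with ⟨h, -⟩ | ⟨h, -⟩ | ⟨h, -⟩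
    · rw [A₁.injective h]; exact hn₁
    · rw [A₁.injective h]; exact hn₁
    · rw [A₁.injective h]; exact hn₂
  have hjν : ⟪A₁ uⱼ, ν⟫_ℝ = Real.sqrt (2 / 3) := by
    rcases hcases with ⟨-, h⟩ | ⟨-, h⟩ | ⟨-, h⟩
    · rw [A₁.injective h]; exact hn₂
    · rw [A₁.injective h]; exact hn₃
    · rw [A₁.injective h]; exact hn₃
  have dom : ∀ u : EuclideanSpace ℝ (Fin 3), 0 ≤ ⟪A₁ u, e⟫_ℝ → 1 - c ^ 2 ≤ 2 * ⟪A₁ u, e⟫_ℝ ^ 2 →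
      Real.sqrt (1 - ⟪ν, e⟫_ℝ ^ 2) ≤ Real.sqrt 2 * ⟪A₁ u, e⟫_ℝ := by
    intro u hu0 hd
    rw [← hcdef, show Real.sqrt 2 * ⟪A₁ u, e⟫_ℝ = Real.sqrt (2 * ⟪A₁ u, e⟫_ℝ ^ 2) by
      rw [Real.sqrt_mul (by norm_num), Real.sqrt_sq hu0]]
    exact Real.sqrt_le_sqrt hd
  have hwide : ∀ u : EuclideanSpace ℝ (Fin 3), 1 / 2 ≤ ⟪A₁ u, e⟫_ℝ → (9 / 20 : ℝ) ≤ ⟪A₁ u, e⟫_ℝ := fun u h => by linarith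
  have hRi := hreg h3 ν hν hmenu (Or.inl hΛ) uᵢ huᵢ (hwide uᵢ hiw) (dom uᵢ (by linarith) hid) ν hν hmenu hiν (Or.inl hΛ)
  have hRj := hreg h3 ν hν hmenu (Or.inl hΛ) uⱼ huⱼ (hwide uⱼ hjw) (dom uⱼ (by linarith) hjd) ν hν hmenu hjν (Or.inl hΛ)
  obtain ⟨a, ha⟩ := coherentOffset_of_two_registrations A₁ hν hmenu huᵢ huⱼ hij hiν hjν hRi hRj
  exact ⟨hΛ, ν, hν, hmenu, a, ha⟩

/-- **Consequence for the split**: a translation pair of the vicinal core that is NOT a coherent fault has an offset of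
DEEPER level (`3·A₁⁻¹(t₂ − t₁) ∉ Λ₀`). -/
theorem incoherent_trans_not_level_third
    (A₁ : EuclideanSpace ℝ (Fin 3) ≃ₗᵢ[ℝ] EuclideanSpace ℝ (Fin 3)) (t₁ : EuclideanSpace ℝ (Fin 3))
    (A₂ : EuclideanSpace ℝ (Fin 3) ≃ₗᵢ[ℝ] EuclideanSpace ℝ (Fin 3)) (t₂ : EuclideanSpace ℝ (Fin 3))
    (hV : VicinalPair A₁ t₁ A₂ t₂) (hnot : ¬ CoherentFaultPair A₁ t₁ A₂ t₂)
    (hΛ : A₂ '' fccStacking 1 (Real.sqrt (2 / 3)) = A₁ '' fccStacking 1 (Real.sqrt (2 / 3))) :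
    A₁.symm ((3 : ℝ) • (t₂ - t₁)) ∉ fccStacking 1 (Real.sqrt (2 / 3)) :=
  fun h3 => hnot (coherentFaultPair_of_vicinal_level_third A₁ t₁ A₂ t₂ hV hΛ h3)

end Summit.Ventures.Crystal3D.Theorems

end
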